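import Mathlib
import Literature.NumberTheory.LFunctions.Zhang2022.Section15BLocalEstimates
import HarnessLib

/-!
# Zhang (2022), §15 p. 84: `𝓜₁(d,l;s) = ζ(s)L(s,χ)ζ(s+β₁)⁻¹ζ(s+β₂)⁻¹Σ_n λ̃₁ξ₁n^{−s}` for `σ > 1` —
# the edge `§15.u034 (identity) ⇐ §15.u030`, kernel-checked

Topic `Literature/NumberTheory/LFunctions/Zhang2022` (Landau–Siegel audit tree; verdict-neutral).
Y. Zhang, *Discrete mean estimates and the Landau–Siegel zero*, arXiv:2211.02515v1 (2022)
[Zhang2022LandauSiegel] — **an unrefereed manuscript under adjudication; nothing here asserts or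
denies its Theorems 1–2.** Campaign D-0069, DAG node `Z22:§15.u034` [Z22 p.84, tex L4186–L4205]:

> for `σ > 1`, `Σ_n λ̃₁(n,d)ξ₁(n;d,l)n^{−s} = ∏_q (1 + λ̃₁(q,d)Σ_r ξ₁(qʳ;d,l)q^{−rs})` [§15.u030] …
> It follows that the function `𝓜₁(d,l;s) := ζ(s)L(s,χ)ζ(s+β₁)⁻¹ζ(s+β₂)⁻¹Σ_n λ̃₁(n,d)ξ₁(n;d,l)n^{−s}` …

`TypedSection15B` DEFINES `𝓜₁ = calM1 := ∏'_q calM1Factor q` (the Euler product of p. 84) and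
states the identity with the printed Dirichlet-series expression `calM1Series` on `σ > 1` as the
CLAIM `Step15_u034`. This file PROVES `Step15_u034` from `Step15_u030` (theorems only, no new
definitions, no facts): the Euler products of `ζ(s)`, `L(s,χ)`, `ζ(s+β₁)`, `ζ(s+β₂)` (Mathlib
`riemannZeta_eulerProduct_hasProd`, `DirichletCharacter.LSeries_eulerProduct_hasProd`; `β_j` is
purely imaginary so `Re(s+β_j) = σ > 1`, and `ζ(s+β_j) ≠ 0` there) multiply to the product of the
prefactors `(1−q^{−s−β₁})(1−q^{−s−β₂})(1−q^{−s})⁻¹(1−χ(q)q^{−s})⁻¹`; the second factors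
`1 + λ̃₁(q,d)Σ_rξ₁(qʳ;d,l)q^{−rs}` form a convergent product BY THEMSELVES for `σ > 1`
(`|λ̃₁(q,d)| ≤ 5`, `|Σ_r ξ₁(qʳ;d,l)q^{−rs}| ≤ Kq^{−σ}`, both in `Section15BLocalEstimates`), whose value
is the Dirichlet series by `Step15_u030`; `HasProd.mul` assembles `calM1 = calM1Series`.

* `multipliable_euler15_second` — `∏_q (1 + λ̃₁(q,d)Σ_rξ₁q^{−rs})` converges for `σ > 1`;
* **`step15_u034_of : Step15_u030 c′ → Step15_u034 c′`**.

WHAT THIS IS NOT: a proof of `Step15_u030` (the multiplicativity / Euler product of `λ̃₁ξ₁`, a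
CLAIM), or of anything about Theorems 1–2 / Landau–Siegel zeros.

## References

* Y. Zhang, arXiv:2211.02515v1 (2022), §15 p. 84. [cite: Zhang2022LandauSiegel, §15 p. 84]
-/

noncomputable section

open Complex Real Filter Topology

namespace Literature.NumberTheory.LFunctions.Zhang2022.Typed.Section15B

open Literature.NumberTheory.LFunctions.Zhang2022
open Literature.NumberTheory.LFunctions.Zhang2022.Typed.Section15A

/-! ## The second Euler factors -/

/-- **The second Euler factors form a convergent product for `σ > 1`:**
`∏_q (1 + λ̃₁(q,d)Σ_rξ₁(qʳ;d,l)q^{−rs})` is `Multipliable` over the primes, since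
`Σ_q |λ̃₁(q,d)Σ_rξ₁q^{−rs}| ≤ 5K·Σ_q q^{−σ} < ∞` (`norm_lamTilde1_prime_le`, `norm_xi1LocalSeries_le` of
`Section15BLocalEstimates`). [cite: Zhang2022LandauSiegel, §15 p. 84] -/
theorem multipliable_euler15_second (c' : ℝ) {D : ℕ} (χ : DirichletCharacter ℂ D) (d l : ℕ)
    {s : ℂ} (hs : 1 < s.re) :
    Multipliable fun q : Nat.Primes =>
      1 + lamTilde1 c' χ (q : ℕ) d * xi1LocalSeries c' χ (q : ℕ) d l s := by
  set K : ℝ := (16 / 3) * (∑' k : ℕ, ((k : ℝ) + 1) ^ 2 * (1 / 2 : ℝ) ^ k) *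
    (∑' k : ℕ, ((k : ℝ) + 1) ^ 3 * (3 / 4 : ℝ) ^ k) with hK
  have hK0 : 0 ≤ K := by
    have h2 : 0 ≤ ∑' k : ℕ, ((k : ℝ) + 1) ^ 2 * (1 / 2 : ℝ) ^ k := tsum_nonneg fun k => by positivity
    have h3 : 0 ≤ ∑' k : ℕ, ((k : ℝ) + 1) ^ 3 * (3 / 4 : ℝ) ^ k := tsum_nonneg fun k => by positivity
    rw [hK]; positivity
  have hmaj : Summable fun q : Nat.Primes => 5 * K * ((q : ℕ) : ℝ) ^ (-s.re) := by
    have h : Summable fun n : ℕ => (n : ℝ) ^ (-s.re) :=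
      Real.summable_nat_rpow.mpr (by linarith)
    exact (h.comp_injective Subtype.val_injective).mul_left (5 * K)
  have hsum : Summable fun q : Nat.Primes =>
      ‖lamTilde1 c' χ (q : ℕ) d * xi1LocalSeries c' χ (q : ℕ) d l s‖ := by
    refine Summable.of_nonneg_of_le (fun _ => norm_nonneg _) (fun q => ?_) hmaj
    rw [norm_mul]
    have h1 := norm_lamTilde1_prime_le c' χ q.prop d
    have h2 := norm_xi1LocalSeries_le c' χ q.prop d l (show 9 / 10 < s.re by linarith)
    have h0 : 0 ≤ K * ((q : ℕ) : ℝ) ^ (-s.re) := by positivity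
    calc ‖lamTilde1 c' χ (q : ℕ) d‖ * ‖xi1LocalSeries c' χ (q : ℕ) d l s‖
        ≤ 5 * (K * ((q : ℕ) : ℝ) ^ (-s.re)) :=
          mul_le_mul h1 h2 (norm_nonneg _) (by norm_num)
      _ = 5 * K * ((q : ℕ) : ℝ) ^ (-s.re) := by ring
  exact multipliable_one_add_of_summable hsum

/-! ## The edge `§15.u034 (identity on σ > 1) ⇐ §15.u030` -/

/-- An Euler product with nonvanishing value may be inverted factorwise: `∏' f = a ≠ 0` ⇒
`∏' f⁻¹ = a⁻¹` (in `ℂ`, where `x ↦ x⁻¹` is continuous away from `0`). [folklore] -/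
private theorem hasProd_inv_of_ne_zero {ι : Type*} {f : ι → ℂ} {a : ℂ} (hf : HasProd f a)
    (ha : a ≠ 0) : HasProd (fun i => (f i)⁻¹) a⁻¹ := by
  classical
  have hT : Tendsto (fun A : Finset ι => ∏ i ∈ A, f i) atTop (𝓝 a) := hf
  have hT' := hT.inv₀ ha
  have hfun : (fun A : Finset ι => ∏ i ∈ A, (f i)⁻¹) = fun A => (∏ i ∈ A, f i)⁻¹ := by
    funext A; rw [Finset.prod_inv_distrib]
  show Tendsto (fun A : Finset ι => ∏ i ∈ A, (f i)⁻¹) atTop (𝓝 a⁻¹)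
  rw [hfun]; exact hT'

/-- **`𝓜₁(d,l;s) = ζ(s)L(s,χ)ζ(s+β₁)⁻¹ζ(s+β₂)⁻¹ Σ_n λ̃₁(n,d)ξ₁(n;d,l)n^{−s}` for `σ > 1`, from
§15.u030** (DAG `Z22:§15.u034`, the identity clause; [Z22 p.84, tex L4186–L4205]): the Euler
products of `ζ(s)`, `L(s,χ)`, `ζ(s+β₁)⁻¹`, `ζ(s+β₂)⁻¹` (`Re(s+β_j) = σ > 1`, `ζ(s+β_j) ≠ 0`) give the
prefactor product, `Step15_u030` the second product (convergent by `multipliable_euler15_second`),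
and `HasProd.mul` the product of the two. [cite: Zhang2022LandauSiegel, §15 p. 84] -/
theorem step15_u034_of (c' : ℝ) (h30 : Step15_u030 c') : Step15_u034 c' := by
  intro D _ χ d l hd hl s hs
  classical
  set β₁ : ℂ := Skeleton.beta1 c' D with hβ₁
  set β₂ : ℂ := Skeleton.beta2 c' D with hβ₂
  have hs1 : 1 < (s + β₁).re := by rw [hβ₁, re_add_beta1]; exact hs
  have hs2 : 1 < (s + β₂).re := by rw [hβ₂, re_add_beta2]; exact hs
  have hne1 : riemannZeta (s + β₁) ≠ 0 := riemannZeta_ne_zero_of_one_lt_re hs1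
  have hne2 : riemannZeta (s + β₂) ≠ 0 := riemannZeta_ne_zero_of_one_lt_re hs2
  -- the four Euler products
  have hζ : HasProd (fun p : Nat.Primes => (1 - (p : ℂ) ^ (-s))⁻¹) (riemannZeta s) :=
    riemannZeta_eulerProduct_hasProd hs
  have hL : HasProd (fun p : Nat.Primes => (1 - χ ((p : ℕ) : ZMod D) * (p : ℂ) ^ (-s))⁻¹)
      (LSeries (fun n => χ (n : ZMod D)) s) :=
    DirichletCharacter.LSeries_eulerProduct_hasProd χ hs
  have hζ1 : HasProd (fun p : Nat.Primes => 1 - (p : ℂ) ^ (-(s + β₁))) (riemannZeta (s + β₁))⁻¹ := by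
    have h := hasProd_inv_of_ne_zero (riemannZeta_eulerProduct_hasProd hs1) hne1
    simpa only [inv_inv] using h
  have hζ2 : HasProd (fun p : Nat.Primes => 1 - (p : ℂ) ^ (-(s + β₂))) (riemannZeta (s + β₂))⁻¹ := by
    have h := hasProd_inv_of_ne_zero (riemannZeta_eulerProduct_hasProd hs2) hne2
    simpa only [inv_inv] using h
  -- the prefactor product
  have hR : HasProd (fun p : Nat.Primes =>
      (1 - (p : ℂ) ^ (-(s + β₁))) * (1 - (p : ℂ) ^ (-(s + β₂))) /
        ((1 - (p : ℂ) ^ (-s)) * (1 - χ ((p : ℕ) : ZMod D) * (p : ℂ) ^ (-s))))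
      ((riemannZeta (s + β₁))⁻¹ * (riemannZeta (s + β₂))⁻¹ *
        (riemannZeta s * LSeries (fun n => χ (n : ZMod D)) s)) := by
    have h := (hζ1.mul hζ2).mul (hζ.mul hL)
    have hfun : (fun p : Nat.Primes =>
        (1 - (p : ℂ) ^ (-(s + β₁))) * (1 - (p : ℂ) ^ (-(s + β₂))) /
          ((1 - (p : ℂ) ^ (-s)) * (1 - χ ((p : ℕ) : ZMod D) * (p : ℂ) ^ (-s)))) =
        fun p : Nat.Primes => (1 - (p : ℂ) ^ (-(s + β₁))) * (1 - (p : ℂ) ^ (-(s + β₂))) *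
          ((1 - (p : ℂ) ^ (-s))⁻¹ * (1 - χ ((p : ℕ) : ZMod D) * (p : ℂ) ^ (-s))⁻¹) := by
      funext p; rw [div_eq_mul_inv, mul_inv]
    rw [hfun]; exact h
  -- the second factors
  have hE := (multipliable_euler15_second c' χ d l hs).hasProd
  -- assemble
  have hprod : HasProd (fun p : Nat.Primes => calM1Factor c' χ (p : ℕ) d l s)
      ((riemannZeta (s + β₁))⁻¹ * (riemannZeta (s + β₂))⁻¹ *
          (riemannZeta s * LSeries (fun n => χ (n : ZMod D)) s) *
        ∏' q : Nat.Primes, (1 + lamTilde1 c' χ (q : ℕ) d * xi1LocalSeries c' χ (q : ℕ) d l s)) := by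
    have h := hR.mul hE
    exact h
  unfold calM1
  rw [hprod.tprod_eq]
  unfold calM1Series
  rw [h30 D χ d l hd hl s hs, DirichletCharacter.LFunction_eq_LSeries χ hs, div_eq_mul_inv, mul_inv]
  ring

end Literature.NumberTheory.LFunctions.Zhang2022.Typed.Section15B

end
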